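import Literature.Barriers.CriticalPhenomena.PlaquetteWalkHoleRootLawLBoxes
import Literature.Barriers.CriticalPhenomena.PlaquetteWalkHoleRootInteriorNoKill
import HarnessLib

/-!
# Barrier catalogue (SAWScalingLimit): LAW L AS A DICHOTOMY FOR ALL BOXES — a corner cell removed alone kills its route
if and only if it is a boundary cell; cells away from the hole's neighbourhood kill nothing

Leaf of «LAW L FOR ALL BOXES» (`PlaquetteWalkHoleRootLawLBoxes`: the kill half through the box corridors, `boxMinus`) and
«INTERIOR NO-KILL» (`PlaquetteWalkHoleRootInteriorNoKill`: free wound witnesses around an interior corner cell and the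
transport `exists_wound_witness_shift`). In the `m × n` box with the hole `h` at distance `≥ 2` from every side, rooted at the
`W` side of `w = (h.1 + 1, h.2)`, far cell `(h.1 − 1, h.2)`:

* §2, ONE corner cell `K` removed alone (`boxMinus m n [h, K]`), at every angle `θ`: ★★★★★ `lawL_box_under_w2_killed_iff`
  (`K = K_S2 = (h.1 − 2, h.2 − 2)`): every wound class-`B2a` under-walk at the far cell is `w₂`-marked off the far cell
  **iff** `h.1 = 2 ∨ h.2 = 2` (the cell lies on the west or the bottom wall); `lawL_box_over_w1_killed_iff` (`K_N1`): … iff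
  `h.1 = 2 ∨ h.2 + 3 = n`; `lawL_box_under_w1_killed_iff` (`K_S1`): … iff `h.1 + 3 = m ∨ h.2 = 2`;
  `lawL_box_over_w2_killed_iff` (`K_N2`): … iff `h.1 + 3 = m ∨ h.2 + 3 = n`. (⇐) is the closed-corridor kill
  (`ΩG.under_killed_of_killSW_corridor`, … with `isCorridorSW_boxMinus`, …); (⇒) is the interior witness: off both walls the
  box contains the witness block one column and one row beyond `K` (`interiorBlockSW_hroot_subset_boxMinus`, …) and the free
  wound walk of `exists_under_w2free_of_interiorBlockSW` refutes the universal kill.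
* §3 the schema leaf's four block witnesses (over `w₂`-free / under `w₁`-free in `westBlock`, under `w₂`-free / over `w₁`-free
  in `eastBlock`) carried THEMSELVES to every position (★★★ `exists_over_w2free_of_westBlock`, …); §4 hence a domain containing
  the hole's whole `5 × 5` neighbourhood satisfies NONE of the four kill predicates (`not_killed_of_blocks`); §5, all boxes:
  removing the hole and ANY family of cells outside its `5 × 5` neighbourhood (`FarFromHole`) kills nothing
  (★★★★ `lawL_box_not_killed_of_far`).

Together: the venture lane's pre-registered LAW L (`FINDING-YB-KILL-FORCED-ZEROS.md` §5: the four corner cells kill iff they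
are boundary cells; no other boundary cell kills — scored 272/272 by enumeration on 13 frames) for every box and hole, except
the twelve non-corner boundary cells INSIDE the neighbourhood that exist when the hole is at distance exactly `2` from a wall
(there the small frames show emptied routes; not claimed).

Not in print; venture lane «pcv-sawmu», seat b-step0 gen 26.

References: A. Glazman, I. Manolescu, arXiv:1708.00395v3, §1 (Fig. 1, Fig. 2), §2.1, §4.2 (translation invariance) and
Lemma 2.1 [GlazmanManolescu2019]; A. Glazman, Electron. Commun. Probab. 20 (2015) no. 86, Lemma 3.1, proof pp. 6–7
[Glazman2015WeightedSAW]; R. Courant, H. Robbins, *What is Mathematics?* (1941/1958), Ch. V Appendix §2 (the even–odd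
rule) [CourantRobbins1958].
-/

noncomputable section

open Set Function Complex

namespace Literature.Barriers.CriticalPhenomena.PlaquetteWalk

open Literature.Probability.RandomPlanarGeometry.SAW.YangBaxter
open Real Complex

/-! ## §1 The far cell of a box is rooted; the interior witness blocks sit in the box -/

section Blocks

variable {m n : ℕ} {S : List Face} {h : Face}

/-- The far cell of the hole root of a box minus the hole (and cells off the hole's row) is rooted.
[cite: GlazmanManolescu2019, §2.1 (walks start on the boundary of the domain)] -/
theorem rootedFace_hroot_boxMinus (hW : 2 ≤ h.1) (hE : h.1 + 3 ≤ m) (hS : 2 ≤ h.2) (hN : h.2 + 3 ≤ n) (hh : h ∈ S)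
    (hSl : ∀ s ∈ S, s = h ∨ s.2 ≠ h.2) :
    RootedFace (dom (boxMinus m n S)) (Face.side (h.1 + 1, h.2) .W) (farW (h.1 + 1, h.2)) := by
  refine ⟨farW_hroot_mem_boxMinus hW hE hS hN hSl, fun hb => ?_⟩
  rw [root_faces_W, holeFaceW_hroot] at hb
  exact not_mem_dom_boxMinus_of_mem hh hb.1

/-- The cells of the `K_S2`-interior block, in coordinates. [cite: GlazmanManolescu2019, §2.1 (finite domains of faces)] -/
theorem interiorBlockSW42_bounds : ∀ c ∈ interiorBlockSW42,
    0 ≤ c.1 ∧ c.1 ≤ 5 ∧ -1 ≤ c.2 ∧ c.2 ≤ 3 ∧ c ≠ (3, 2) ∧ c ≠ (1, 0) := by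
  decide

/-- The cells of the `K_N1`-interior block, in coordinates. [cite: GlazmanManolescu2019, §2.1 (finite domains of faces)] -/
theorem interiorBlockNW42_bounds : ∀ c ∈ interiorBlockNW42,
    0 ≤ c.1 ∧ c.1 ≤ 5 ∧ 1 ≤ c.2 ∧ c.2 ≤ 5 ∧ c ≠ (3, 2) ∧ c ≠ (1, 4) := by
  decide

/-- The cells of the `K_S1`-interior block, in coordinates. [cite: GlazmanManolescu2019, §2.1 (finite domains of faces)] -/
theorem interiorBlockSE42_bounds : ∀ c ∈ interiorBlockSE42,
    1 ≤ c.1 ∧ c.1 ≤ 6 ∧ -1 ≤ c.2 ∧ c.2 ≤ 3 ∧ c ≠ (3, 2) ∧ c ≠ (5, 0) := by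
  decide

/-- The cells of the `K_N2`-interior block, in coordinates. [cite: GlazmanManolescu2019, §2.1 (finite domains of faces)] -/
theorem interiorBlockNE42_bounds : ∀ c ∈ interiorBlockNE42,
    1 ≤ c.1 ∧ c.1 ≤ 6 ∧ 1 ≤ c.2 ∧ c.2 ≤ 5 ∧ c ≠ (3, 2) ∧ c ≠ (5, 4) := by
  decide

/-- **The `K_S2`-interior block sits in the box** when `K_S2` is off the west and bottom walls.
[cite: GlazmanManolescu2019, §2.1 (finite domains of faces), §4.2 (translation invariance)] -/
theorem interiorBlockSW_hroot_subset_boxMinus (hW : 3 ≤ h.1) (hE : h.1 + 3 ≤ m) (hS : 3 ≤ h.2) (hN : h.2 + 3 ≤ n) :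
    ∀ c ∈ interiorBlockSW (h.1 + 1, h.2), c ∈ boxMinus m n [h, killSW (h.1 + 1, h.2)] := by
  intro c hc
  simp only [interiorBlockSW, List.mem_map] at hc
  obtain ⟨a, ha, rfl⟩ := hc
  obtain ⟨b1, b2, b3, b4, b5, b6⟩ := interiorBlockSW42_bounds a ha
  obtain ⟨x, y⟩ := a
  simp only [ne_eq, Prod.mk.injEq, not_and] at b1 b2 b3 b4 b5 b6
  rw [shiftBy_refShift_mk, mem_boxMinus]
  simp only [List.mem_cons, List.not_mem_nil, or_false, not_or]
  refine ⟨⟨by omega, by omega, by omega, by omega⟩, fun e => ?_, fun e => ?_⟩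
  · have e' := Prod.ext_iff.1 e; simp only at e'; omega
  · have e' := Prod.ext_iff.1 e; simp only [killSW] at e'; omega

/-- **The `K_N1`-interior block sits in the box** when `K_N1` is off the west and top walls.
[cite: GlazmanManolescu2019, §2.1 (finite domains of faces), §4.2 (translation invariance)] -/
theorem interiorBlockNW_hroot_subset_boxMinus (hW : 3 ≤ h.1) (hE : h.1 + 3 ≤ m) (hS : 2 ≤ h.2) (hN : h.2 + 4 ≤ n) :
    ∀ c ∈ interiorBlockNW (h.1 + 1, h.2), c ∈ boxMinus m n [h, killNW (h.1 + 1, h.2)] := by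
  intro c hc
  simp only [interiorBlockNW, List.mem_map] at hc
  obtain ⟨a, ha, rfl⟩ := hc
  obtain ⟨b1, b2, b3, b4, b5, b6⟩ := interiorBlockNW42_bounds a ha
  obtain ⟨x, y⟩ := a
  simp only [ne_eq, Prod.mk.injEq, not_and] at b1 b2 b3 b4 b5 b6
  rw [shiftBy_refShift_mk, mem_boxMinus]
  simp only [List.mem_cons, List.not_mem_nil, or_false, not_or]
  refine ⟨⟨by omega, by omega, by omega, by omega⟩, fun e => ?_, fun e => ?_⟩
  · have e' := Prod.ext_iff.1 e; simp only at e'; omega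
  · have e' := Prod.ext_iff.1 e; simp only [killNW] at e'; omega

/-- **The `K_S1`-interior block sits in the box** when `K_S1` is off the east and bottom walls.
[cite: GlazmanManolescu2019, §2.1 (finite domains of faces), §4.2 (translation invariance)] -/
theorem interiorBlockSE_hroot_subset_boxMinus (hW : 2 ≤ h.1) (hE : h.1 + 4 ≤ m) (hS : 3 ≤ h.2) (hN : h.2 + 3 ≤ n) :
    ∀ c ∈ interiorBlockSE (h.1 + 1, h.2), c ∈ boxMinus m n [h, killSE (h.1 + 1, h.2)] := by
  intro c hc
  simp only [interiorBlockSE, List.mem_map] at hc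
  obtain ⟨a, ha, rfl⟩ := hc
  obtain ⟨b1, b2, b3, b4, b5, b6⟩ := interiorBlockSE42_bounds a ha
  obtain ⟨x, y⟩ := a
  simp only [ne_eq, Prod.mk.injEq, not_and] at b1 b2 b3 b4 b5 b6
  rw [shiftBy_refShift_mk, mem_boxMinus]
  simp only [List.mem_cons, List.not_mem_nil, or_false, not_or]
  refine ⟨⟨by omega, by omega, by omega, by omega⟩, fun e => ?_, fun e => ?_⟩
  · have e' := Prod.ext_iff.1 e; simp only at e'; omega
  · have e' := Prod.ext_iff.1 e; simp only [killSE] at e'; omega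

/-- **The `K_N2`-interior block sits in the box** when `K_N2` is off the east and top walls.
[cite: GlazmanManolescu2019, §2.1 (finite domains of faces), §4.2 (translation invariance)] -/
theorem interiorBlockNE_hroot_subset_boxMinus (hW : 2 ≤ h.1) (hE : h.1 + 4 ≤ m) (hS : 2 ≤ h.2) (hN : h.2 + 4 ≤ n) :
    ∀ c ∈ interiorBlockNE (h.1 + 1, h.2), c ∈ boxMinus m n [h, killNE (h.1 + 1, h.2)] := by
  intro c hc
  simp only [interiorBlockNE, List.mem_map] at hc
  obtain ⟨a, ha, rfl⟩ := hc
  obtain ⟨b1, b2, b3, b4, b5, b6⟩ := interiorBlockNE42_bounds a ha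
  obtain ⟨x, y⟩ := a
  simp only [ne_eq, Prod.mk.injEq, not_and] at b1 b2 b3 b4 b5 b6
  rw [shiftBy_refShift_mk, mem_boxMinus]
  simp only [List.mem_cons, List.not_mem_nil, or_false, not_or]
  refine ⟨⟨by omega, by omega, by omega, by omega⟩, fun e => ?_, fun e => ?_⟩
  · have e' := Prod.ext_iff.1 e; simp only at e'; omega
  · have e' := Prod.ext_iff.1 e; simp only [killNE] at e'; omega

end Blocks

/-! ## §2 LAW L as a dichotomy: the corner cell kills its route iff it is a boundary cell -/

section Dichotomy

variable {m n : ℕ} {h : Face}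

/-- ★★★★★ **LAW L, `K_S2`, AS A DICHOTOMY FOR ALL BOXES.** In the `m × n` box with the hole `h` at distance `≥ 2` from every
side and the corner cell `K_S2 = (h.1 − 2, h.2 − 2)` removed alone, every wound class-`B2a` UNDER-walk at the far cell is
`w₂`-marked off the far cell (the under route is `w₂`-KILLED) if and only if `K_S2` is a BOUNDARY cell of the box
(`h.1 = 2`: west wall, or `h.2 = 2`: bottom wall). [cite: GlazmanManolescu2019, §1 (the paragraph of Fig. 2: «if θ = π/3, then w₂ = 0»), Lemma 2.1]
[cite: Glazman2015WeightedSAW, Lemma 3.1 (proof, pp. 6–7)] [cite: CourantRobbins1958, Ch. V Appendix §2 (the even–odd rule)] -/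
theorem lawL_box_under_w2_killed_iff (hW : 2 ≤ h.1) (hE : h.1 + 3 ≤ m) (hS : 2 ≤ h.2) (hN : h.2 + 3 ≤ n)
    (hr : RootedFace (dom (boxMinus m n [h, killSW (h.1 + 1, h.2)])) (Face.side (h.1 + 1, h.2) .W)
      (farW (h.1 + 1, h.2))) (θ : ℝ) :
    (∀ (ω : ΩG (dom (boxMinus m n [h, killSW (h.1 + 1, h.2)])) (Face.side (h.1 + 1, h.2) .W) (farW (h.1 + 1, h.2)))
        (hb : ω.IsB2a), ω.2.firstSideG = .S →
        ω.WE (fun _ => θ) ≠ excursionWinding θ ω.2.firstSideG (ω.z1 hr hb) ω.1 → ¬ω.2.W2FreeOff (farW (h.1 + 1, h.2)))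
      ↔ (h.1 = 2 ∨ h.2 = 2) := by
  constructor
  · intro hkill
    by_contra hint
    have h3 : 3 ≤ h.1 ∧ 3 ≤ h.2 := by omega
    exact not_under_w2_killed_of_interiorBlockSW (interiorBlockSW_hroot_subset_boxMinus h3.1 hE h3.2 hN) hr θ hkill
  · intro hbdry
    have hh : holeFaceW (h.1 + 1, h.2) ∉ dom (boxMinus m n [h, killSW (h.1 + 1, h.2)]) := by
      rw [holeFaceW_hroot]; exact not_mem_dom_boxMinus_of_mem (by simp)
    refine ΩG.under_killed_of_killSW_corridor hh (not_mem_dom_boxMinus_of_mem (by simp))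
      (isCorridorSW_boxMinus hbdry (by simp)) (fun y hy => ?_) hr θ
    simp only at hy ⊢
    by_cases hD : ((h.1 + 1 - 3, y) : Face) ∈ dom (boxMinus m n [h, killSW (h.1 + 1, h.2)])
    · right; right; simp only [Set.mem_setOf_eq]; exact ⟨hD, by omega, by omega⟩
    · exact Or.inl hD

/-- ★★★★★ **LAW L, `K_N1`, AS A DICHOTOMY**: the over route is `w₁`-killed iff `K_N1 = (h.1 − 2, h.2 + 2)` is a boundary
cell (`h.1 = 2` or `h.2 + 3 = n`). [cite: GlazmanManolescu2019, §1 (remark after eq. (1): «w₁ = 0 at θ = 2π/3»), Lemma 2.1]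
[cite: Glazman2015WeightedSAW, Lemma 3.1 (proof, pp. 6–7)] [cite: CourantRobbins1958, Ch. V Appendix §2 (the even–odd rule)] -/
theorem lawL_box_over_w1_killed_iff (hW : 2 ≤ h.1) (hE : h.1 + 3 ≤ m) (hS : 2 ≤ h.2) (hN : h.2 + 3 ≤ n)
    (hr : RootedFace (dom (boxMinus m n [h, killNW (h.1 + 1, h.2)])) (Face.side (h.1 + 1, h.2) .W)
      (farW (h.1 + 1, h.2))) (θ : ℝ) :
    (∀ (ω : ΩG (dom (boxMinus m n [h, killNW (h.1 + 1, h.2)])) (Face.side (h.1 + 1, h.2) .W) (farW (h.1 + 1, h.2)))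
        (hb : ω.IsB2a), ω.2.firstSideG = .N →
        ω.WE (fun _ => θ) ≠ excursionWinding θ ω.2.firstSideG (ω.z1 hr hb) ω.1 → ¬ω.2.W1FreeOff (farW (h.1 + 1, h.2)))
      ↔ (h.1 = 2 ∨ h.2 + 3 = n) := by
  constructor
  · intro hkill
    by_contra hint
    have h3 : 3 ≤ h.1 ∧ h.2 + 4 ≤ n := by omega
    exact not_over_w1_killed_of_interiorBlockNW (interiorBlockNW_hroot_subset_boxMinus h3.1 hE hS h3.2) hr θ hkill
  · intro hbdry
    have hh : holeFaceW (h.1 + 1, h.2) ∉ dom (boxMinus m n [h, killNW (h.1 + 1, h.2)]) := by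
      rw [holeFaceW_hroot]; exact not_mem_dom_boxMinus_of_mem (by simp)
    refine ΩG.over_killed_of_killNW_corridor hh (not_mem_dom_boxMinus_of_mem (by simp))
      (isCorridorNW_boxMinus hbdry (by simp)) (fun y hy => ?_) hr θ
    simp only at hy ⊢
    by_cases hD : ((h.1 + 1 - 3, y) : Face) ∈ dom (boxMinus m n [h, killNW (h.1 + 1, h.2)])
    · right; right; simp only [Set.mem_setOf_eq]; exact ⟨hD, by omega, by omega⟩
    · exact Or.inl hD

/-- ★★★★★ **LAW L, `K_S1`, AS A DICHOTOMY**: the under route is `w₁`-killed iff `K_S1 = (h.1 + 2, h.2 − 2)` is a boundary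
cell (`h.1 + 3 = m` or `h.2 = 2`). [cite: GlazmanManolescu2019, §1 (remark after eq. (1)), Lemma 2.1]
[cite: Glazman2015WeightedSAW, Lemma 3.1 (proof, pp. 6–7)] [cite: CourantRobbins1958, Ch. V Appendix §2 (the even–odd rule)] -/
theorem lawL_box_under_w1_killed_iff (hW : 2 ≤ h.1) (hE : h.1 + 3 ≤ m) (hS : 2 ≤ h.2) (hN : h.2 + 3 ≤ n)
    (hr : RootedFace (dom (boxMinus m n [h, killSE (h.1 + 1, h.2)])) (Face.side (h.1 + 1, h.2) .W)
      (farW (h.1 + 1, h.2))) (θ : ℝ) :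
    (∀ (ω : ΩG (dom (boxMinus m n [h, killSE (h.1 + 1, h.2)])) (Face.side (h.1 + 1, h.2) .W) (farW (h.1 + 1, h.2)))
        (hb : ω.IsB2a), ω.2.firstSideG = .S →
        ω.WE (fun _ => θ) ≠ excursionWinding θ ω.2.firstSideG (ω.z1 hr hb) ω.1 → ¬ω.2.W1FreeOff (farW (h.1 + 1, h.2)))
      ↔ (h.1 + 3 = m ∨ h.2 = 2) := by
  constructor
  · intro hkill
    by_contra hint
    have h3 : h.1 + 4 ≤ m ∧ 3 ≤ h.2 := by omega
    exact not_under_w1_killed_of_interiorBlockSE (interiorBlockSE_hroot_subset_boxMinus hW h3.1 h3.2 hN) hr θ hkill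
  · intro hbdry
    have hh : holeFaceW (h.1 + 1, h.2) ∉ dom (boxMinus m n [h, killSE (h.1 + 1, h.2)]) := by
      rw [holeFaceW_hroot]; exact not_mem_dom_boxMinus_of_mem (by simp)
    refine ΩG.under_w1_killed_of_killSE_corridor hh (not_mem_dom_boxMinus_of_mem (by simp))
      (isCorridorS_boxMinus hbdry (by simp)) (fun y hy => ?_) hr θ
    simp only at hy ⊢
    by_cases hD : ((h.1 + 1 + 1, y) : Face) ∈ dom (boxMinus m n [h, killSE (h.1 + 1, h.2)])
    · right; right; simp only [Set.mem_setOf_eq]; exact ⟨hD, by omega, by omega⟩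
    · exact Or.inr (Or.inl hD)

/-- ★★★★★ **LAW L, `K_N2`, AS A DICHOTOMY**: the over route is `w₂`-killed iff `K_N2 = (h.1 + 2, h.2 + 2)` is a boundary
cell (`h.1 + 3 = m` or `h.2 + 3 = n`). [cite: GlazmanManolescu2019, §1 (the paragraph of Fig. 2), Lemma 2.1]
[cite: Glazman2015WeightedSAW, Lemma 3.1 (proof, pp. 6–7)] [cite: CourantRobbins1958, Ch. V Appendix §2 (the even–odd rule)] -/
theorem lawL_box_over_w2_killed_iff (hW : 2 ≤ h.1) (hE : h.1 + 3 ≤ m) (hS : 2 ≤ h.2) (hN : h.2 + 3 ≤ n)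
    (hr : RootedFace (dom (boxMinus m n [h, killNE (h.1 + 1, h.2)])) (Face.side (h.1 + 1, h.2) .W)
      (farW (h.1 + 1, h.2))) (θ : ℝ) :
    (∀ (ω : ΩG (dom (boxMinus m n [h, killNE (h.1 + 1, h.2)])) (Face.side (h.1 + 1, h.2) .W) (farW (h.1 + 1, h.2)))
        (hb : ω.IsB2a), ω.2.firstSideG = .N →
        ω.WE (fun _ => θ) ≠ excursionWinding θ ω.2.firstSideG (ω.z1 hr hb) ω.1 → ¬ω.2.W2FreeOff (farW (h.1 + 1, h.2)))
      ↔ (h.1 + 3 = m ∨ h.2 + 3 = n) := by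
  constructor
  · intro hkill
    by_contra hint
    have h3 : h.1 + 4 ≤ m ∧ h.2 + 4 ≤ n := by omega
    exact not_over_w2_killed_of_interiorBlockNE (interiorBlockNE_hroot_subset_boxMinus hW h3.1 hS h3.2) hr θ hkill
  · intro hbdry
    have hh : holeFaceW (h.1 + 1, h.2) ∉ dom (boxMinus m n [h, killNE (h.1 + 1, h.2)]) := by
      rw [holeFaceW_hroot]; exact not_mem_dom_boxMinus_of_mem (by simp)
    refine ΩG.over_w2_killed_of_killNE_corridor hh (not_mem_dom_boxMinus_of_mem (by simp))
      (isCorridorN_boxMinus hbdry (by simp)) (fun y hy => ?_) hr θ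
    simp only at hy ⊢
    by_cases hD : ((h.1 + 1 + 1, y) : Face) ∈ dom (boxMinus m n [h, killNE (h.1 + 1, h.2)])
    · right; right; simp only [Set.mem_setOf_eq]; exact ⟨hD, by omega, by omega⟩
    · exact Or.inr (Or.inl hD)

/-- The rooted far cell of a box minus the hole and one corner cell — the hypothesis `hr` of the dichotomies, discharged.
[cite: GlazmanManolescu2019, §2.1 (walks start on the boundary of the domain)] -/
theorem rootedFace_hroot_boxMinus_killSW (hW : 2 ≤ h.1) (hE : h.1 + 3 ≤ m) (hS : 2 ≤ h.2) (hN : h.2 + 3 ≤ n) :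
    RootedFace (dom (boxMinus m n [h, killSW (h.1 + 1, h.2)])) (Face.side (h.1 + 1, h.2) .W) (farW (h.1 + 1, h.2)) :=
  rootedFace_hroot_boxMinus hW hE hS hN (by simp) fun s hs => by
    simp only [List.mem_cons, List.not_mem_nil, or_false] at hs
    rcases hs with e | e
    · exact Or.inl e
    · right; rw [e]; simp only [killSW]; omega

end Dichotomy

/-! ## §3 The four block witnesses at every position -/

section BlockWitnesses

variable {Dl : List Face} {w : Face}

/-- ★★★ **THE WEST BLOCK'S OVER WITNESS, EVERY POSITION**: any face list containing `westBlock w` carries a class-`B2a`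
OVER-walk at the far cell, wound at every angle, `w₂`-free off the far cell. [cite: GlazmanManolescu2019, §1 (Fig. 2), §4.2, Lemma 2.1]
[cite: Glazman2015WeightedSAW, Lemma 3.1 (proof, pp. 6–7)] [cite: CourantRobbins1958, Ch. V Appendix §2 (the even–odd rule)] -/
theorem exists_over_w2free_of_westBlock (hB : ∀ c ∈ westBlock w, c ∈ Dl) (hr : RootedFace (dom Dl) (w.side .W) (farW w))
    (θ : ℝ) :
    ∃ (ω : ΩG (dom Dl) (w.side .W) (farW w)) (h : ω.IsB2a), ω.2.firstSideG = .N ∧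
      ω.WE (fun _ => θ) ≠ excursionWinding θ ω.2.firstSideG (ω.z1 hr h) ω.1 ∧ ω.2.W2FreeOff (farW w) := by
  have hB₀ := block42_mem_of_block_mem (B := westBlock42) hB
  obtain ⟨hF, hn, hfc, hnth, hfree, hodd⟩ := ωWB_O_cert
  let ω₀ : ΩG (dom (Dl.map (Face.shiftBy (-refShift w)))) (w42.side .W) (farW w42) :=
    ⟨.S, westOver42.mapDomain fun c hc => hB₀ c hc⟩
  have hF' : ω₀.2.firstHitG = 4 := hF
  have hn' : ω₀.2.arcs.length = 18 := hn
  have h₀ : ω₀.IsB2a := by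
    refine ΩG.isB2a_of_forall_fc_ne (by rw [hF', hn']; omega) fun j hj1 hj2 => ?_
    rw [hF'] at hj1
    rw [hn'] at hj2
    exact hfc j hj2 hj1
  have hM : ω₀.Mv = 14 := by unfold ΩG.Mv; rw [hF', hn']
  exact exists_wound_witness_shift (shiftBy_refShift_root w) (shiftBy_refShift_farW w) hr
    (fun γ r => γ.W2FreeOff r) (fun hm _ hf => YBWalk.W2FreeOff_of_mids_shift hm hf) ω₀ h₀
    (by rw [hF']; exact hnth) hfree (by rw [hM, hF']; exact hodd) θ

/-- ★★★ **THE WEST BLOCK'S UNDER WITNESS, EVERY POSITION**: a wound UNDER-walk, `w₁`-free off the far cell.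
[cite: GlazmanManolescu2019, §1 (remark after eq. (1)), §4.2, Lemma 2.1] [cite: Glazman2015WeightedSAW, Lemma 3.1 (proof, pp. 6–7)]
[cite: CourantRobbins1958, Ch. V Appendix §2 (the even–odd rule)] -/
theorem exists_under_w1free_of_westBlock (hB : ∀ c ∈ westBlock w, c ∈ Dl) (hr : RootedFace (dom Dl) (w.side .W) (farW w))
    (θ : ℝ) :
    ∃ (ω : ΩG (dom Dl) (w.side .W) (farW w)) (h : ω.IsB2a), ω.2.firstSideG = .S ∧
      ω.WE (fun _ => θ) ≠ excursionWinding θ ω.2.firstSideG (ω.z1 hr h) ω.1 ∧ ω.2.W1FreeOff (farW w) := by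
  have hB₀ := block42_mem_of_block_mem (B := westBlock42) hB
  obtain ⟨hF, hn, hfc, hnth, hfree, hodd⟩ := ωWB_U_cert
  let ω₀ : ΩG (dom (Dl.map (Face.shiftBy (-refShift w)))) (w42.side .W) (farW w42) :=
    ⟨.N, westUnder42.mapDomain fun c hc => hB₀ c hc⟩
  have hF' : ω₀.2.firstHitG = 4 := hF
  have hn' : ω₀.2.arcs.length = 18 := hn
  have h₀ : ω₀.IsB2a := by
    refine ΩG.isB2a_of_forall_fc_ne (by rw [hF', hn']; omega) fun j hj1 hj2 => ?_
    rw [hF'] at hj1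
    rw [hn'] at hj2
    exact hfc j hj2 hj1
  have hM : ω₀.Mv = 14 := by unfold ΩG.Mv; rw [hF', hn']
  exact exists_wound_witness_shift (shiftBy_refShift_root w) (shiftBy_refShift_farW w) hr
    (fun γ r => γ.W1FreeOff r) (fun hm _ hf => YBWalk.W1FreeOff_of_mids_shift hm hf) ω₀ h₀
    (by rw [hF']; exact hnth) hfree (by rw [hM, hF']; exact hodd) θ

/-- ★★★ **THE EAST BLOCK'S UNDER WITNESS, EVERY POSITION**: a wound UNDER-walk, `w₂`-free off the far cell.
[cite: GlazmanManolescu2019, §1 (Fig. 2), §4.2, Lemma 2.1] [cite: Glazman2015WeightedSAW, Lemma 3.1 (proof, pp. 6–7)]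
[cite: CourantRobbins1958, Ch. V Appendix §2 (the even–odd rule)] -/
theorem exists_under_w2free_of_eastBlock (hB : ∀ c ∈ eastBlock w, c ∈ Dl) (hr : RootedFace (dom Dl) (w.side .W) (farW w))
    (θ : ℝ) :
    ∃ (ω : ΩG (dom Dl) (w.side .W) (farW w)) (h : ω.IsB2a), ω.2.firstSideG = .S ∧
      ω.WE (fun _ => θ) ≠ excursionWinding θ ω.2.firstSideG (ω.z1 hr h) ω.1 ∧ ω.2.W2FreeOff (farW w) := by
  have hB₀ := block42_mem_of_block_mem (B := eastBlock42) hB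
  obtain ⟨hF, hn, hfc, hnth, hfree, hodd⟩ := ωEB_U_cert
  let ω₀ : ΩG (dom (Dl.map (Face.shiftBy (-refShift w)))) (w42.side .W) (farW w42) :=
    ⟨.N, eastUnder42.mapDomain fun c hc => hB₀ c hc⟩
  have hF' : ω₀.2.firstHitG = 4 := hF
  have hn' : ω₀.2.arcs.length = 18 := hn
  have h₀ : ω₀.IsB2a := by
    refine ΩG.isB2a_of_forall_fc_ne (by rw [hF', hn']; omega) fun j hj1 hj2 => ?_
    rw [hF'] at hj1
    rw [hn'] at hj2
    exact hfc j hj2 hj1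
  have hM : ω₀.Mv = 14 := by unfold ΩG.Mv; rw [hF', hn']
  exact exists_wound_witness_shift (shiftBy_refShift_root w) (shiftBy_refShift_farW w) hr
    (fun γ r => γ.W2FreeOff r) (fun hm _ hf => YBWalk.W2FreeOff_of_mids_shift hm hf) ω₀ h₀
    (by rw [hF']; exact hnth) hfree (by rw [hM, hF']; exact hodd) θ

/-- ★★★ **THE EAST BLOCK'S OVER WITNESS, EVERY POSITION**: a wound OVER-walk, `w₁`-free off the far cell.
[cite: GlazmanManolescu2019, §1 (remark after eq. (1)), §4.2, Lemma 2.1] [cite: Glazman2015WeightedSAW, Lemma 3.1 (proof, pp. 6–7)]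
[cite: CourantRobbins1958, Ch. V Appendix §2 (the even–odd rule)] -/
theorem exists_over_w1free_of_eastBlock (hB : ∀ c ∈ eastBlock w, c ∈ Dl) (hr : RootedFace (dom Dl) (w.side .W) (farW w))
    (θ : ℝ) :
    ∃ (ω : ΩG (dom Dl) (w.side .W) (farW w)) (h : ω.IsB2a), ω.2.firstSideG = .N ∧
      ω.WE (fun _ => θ) ≠ excursionWinding θ ω.2.firstSideG (ω.z1 hr h) ω.1 ∧ ω.2.W1FreeOff (farW w) := by
  have hB₀ := block42_mem_of_block_mem (B := eastBlock42) hB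
  obtain ⟨hF, hn, hfc, hnth, hfree, hodd⟩ := ωEB_O_cert
  let ω₀ : ΩG (dom (Dl.map (Face.shiftBy (-refShift w)))) (w42.side .W) (farW w42) :=
    ⟨.S, eastOver42.mapDomain fun c hc => hB₀ c hc⟩
  have hF' : ω₀.2.firstHitG = 4 := hF
  have hn' : ω₀.2.arcs.length = 18 := hn
  have h₀ : ω₀.IsB2a := by
    refine ΩG.isB2a_of_forall_fc_ne (by rw [hF', hn']; omega) fun j hj1 hj2 => ?_
    rw [hF'] at hj1
    rw [hn'] at hj2
    exact hfc j hj2 hj1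
  have hM : ω₀.Mv = 14 := by unfold ΩG.Mv; rw [hF', hn']
  exact exists_wound_witness_shift (shiftBy_refShift_root w) (shiftBy_refShift_farW w) hr
    (fun γ r => γ.W1FreeOff r) (fun hm _ hf => YBWalk.W1FreeOff_of_mids_shift hm hf) ω₀ h₀
    (by rw [hF']; exact hnth) hfree (by rw [hM, hF']; exact hodd) θ

end BlockWitnesses

/-! ## §4 Both blocks present ⇒ none of the four kill predicates holds -/

section NoKill

variable {Dl : List Face} {w : Face}

/-- ★★★ **NO KILL WITH THE HOLE'S WHOLE NEIGHBOURHOOD PRESENT.** If a face list contains both witness blocks around `w` (the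
24 cells of the `5 × 5` neighbourhood of the hole other than the hole), then at every angle the far cell carries wound walks of
BOTH routes that are `w₂`-free AND wound walks of both routes that are `w₁`-free: none of the four universal kill statements of
LAW L holds. [cite: GlazmanManolescu2019, §1 (Fig. 2 and the remark after eq. (1)), Lemma 2.1]
[cite: Glazman2015WeightedSAW, Lemma 3.1 (proof, pp. 6–7)] [cite: CourantRobbins1958, Ch. V Appendix §2 (the even–odd rule)] -/
theorem not_killed_of_blocks (hW : ∀ c ∈ westBlock w, c ∈ Dl) (hE : ∀ c ∈ eastBlock w, c ∈ Dl)
    (hr : RootedFace (dom Dl) (w.side .W) (farW w)) (θ : ℝ) :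
    (¬ ∀ (ω : ΩG (dom Dl) (w.side .W) (farW w)) (h : ω.IsB2a), ω.2.firstSideG = .S →
        ω.WE (fun _ => θ) ≠ excursionWinding θ ω.2.firstSideG (ω.z1 hr h) ω.1 → ¬ω.2.W2FreeOff (farW w)) ∧
      (¬ ∀ (ω : ΩG (dom Dl) (w.side .W) (farW w)) (h : ω.IsB2a), ω.2.firstSideG = .N →
        ω.WE (fun _ => θ) ≠ excursionWinding θ ω.2.firstSideG (ω.z1 hr h) ω.1 → ¬ω.2.W1FreeOff (farW w)) ∧
      (¬ ∀ (ω : ΩG (dom Dl) (w.side .W) (farW w)) (h : ω.IsB2a), ω.2.firstSideG = .S →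
        ω.WE (fun _ => θ) ≠ excursionWinding θ ω.2.firstSideG (ω.z1 hr h) ω.1 → ¬ω.2.W1FreeOff (farW w)) ∧
      (¬ ∀ (ω : ΩG (dom Dl) (w.side .W) (farW w)) (h : ω.IsB2a), ω.2.firstSideG = .N →
        ω.WE (fun _ => θ) ≠ excursionWinding θ ω.2.firstSideG (ω.z1 hr h) ω.1 → ¬ω.2.W2FreeOff (farW w)) := by
  refine ⟨fun hk => ?_, fun hk => ?_, fun hk => ?_, fun hk => ?_⟩
  · obtain ⟨ω, h, hs, hw, hf⟩ := exists_under_w2free_of_eastBlock hE hr θ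
    exact hk ω h hs hw hf
  · obtain ⟨ω, h, hs, hw, hf⟩ := exists_over_w1free_of_eastBlock hE hr θ
    exact hk ω h hs hw hf
  · obtain ⟨ω, h, hs, hw, hf⟩ := exists_under_w1free_of_westBlock hW hr θ
    exact hk ω h hs hw hf
  · obtain ⟨ω, h, hs, hw, hf⟩ := exists_over_w2free_of_westBlock hW hr θ
    exact hk ω h hs hw hf

end NoKill

/-! ## §5 LAW L's non-kill half for far cells, all boxes -/

section Boxes

variable {m n : ℕ} {S : List Face} {h : Face}

/-- A cell is FAR from the hole: outside its `5 × 5` neighbourhood. [cite: GlazmanManolescu2019, §2.1 (finite domains of faces)] -/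
def FarFromHole (h c : Face) : Prop := c.1 + 3 ≤ h.1 ∨ h.1 + 3 ≤ c.1 ∨ c.2 + 3 ≤ h.2 ∨ h.2 + 3 ≤ c.2

/-- **Both witness blocks sit in the box minus far cells**: the hole `≥ 2` from every side, every removed cell the hole itself or
far from it. [cite: GlazmanManolescu2019, §2.1 (finite domains of faces), §4.2 (translation invariance)] -/
theorem blocks_hroot_subset_boxMinus_of_far (hW : 2 ≤ h.1) (hE : h.1 + 3 ≤ m) (hS : 2 ≤ h.2) (hN : h.2 + 3 ≤ n)
    (hSl : ∀ s ∈ S, s = h ∨ FarFromHole h s) :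
    (∀ c ∈ westBlock (h.1 + 1, h.2), c ∈ boxMinus m n S) ∧ (∀ c ∈ eastBlock (h.1 + 1, h.2), c ∈ boxMinus m n S) := by
  constructor
  · intro c hc
    simp only [westBlock, List.mem_map] at hc
    obtain ⟨a, ha, rfl⟩ := hc
    obtain ⟨b1, b2, b3, b4, b5, b6, b7⟩ := westBlock42_bounds a ha
    obtain ⟨x, y⟩ := a
    simp only [ne_eq, Prod.mk.injEq, not_and] at b1 b2 b3 b4 b5 b6 b7
    rw [shiftBy_refShift_mk, mem_boxMinus]
    simp only
    refine ⟨⟨by omega, by omega, by omega, by omega⟩, fun hs => ?_⟩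
    rcases hSl _ hs with e | e
    · have e' := Prod.ext_iff.1 e; simp only at e'; omega
    · simp only [FarFromHole] at e; omega
  · intro c hc
    simp only [eastBlock, List.mem_map] at hc
    obtain ⟨a, ha, rfl⟩ := hc
    obtain ⟨b1, b2, b3, b4, b5, b6, b7⟩ := eastBlock42_bounds a ha
    obtain ⟨x, y⟩ := a
    simp only [ne_eq, Prod.mk.injEq, not_and] at b1 b2 b3 b4 b5 b6 b7
    rw [shiftBy_refShift_mk, mem_boxMinus]
    simp only
    refine ⟨⟨by omega, by omega, by omega, by omega⟩, fun hs => ?_⟩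
    rcases hSl _ hs with e | e
    · have e' := Prod.ext_iff.1 e; simp only at e'; omega
    · simp only [FarFromHole] at e; omega

/-- ★★★★ **LAW L's NON-KILL HALF FOR FAR CELLS, ALL BOXES.** In the `m × n` box with the hole `h` at distance `≥ 2` from every
side, remove the hole and ANY family of cells all outside the hole's `5 × 5` neighbourhood (`FarFromHole`). Then at every
angle the far cell of the hole root carries wound under- and over-walks free of `w₂` and free of `w₁`: NOTHING is killed —
no far boundary cell (or set of far cells) kills a route. [cite: GlazmanManolescu2019, §1 (Fig. 2 and the remark after eq. (1)), §2.1, Lemma 2.1]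
[cite: Glazman2015WeightedSAW, Lemma 3.1 (proof, pp. 6–7)] [cite: CourantRobbins1958, Ch. V Appendix §2 (the even–odd rule)] -/
theorem lawL_box_not_killed_of_far (hW : 2 ≤ h.1) (hE : h.1 + 3 ≤ m) (hS : 2 ≤ h.2) (hN : h.2 + 3 ≤ n)
    (hSl : ∀ s ∈ S, s = h ∨ FarFromHole h s)
    (hr : RootedFace (dom (boxMinus m n S)) (Face.side (h.1 + 1, h.2) .W) (farW (h.1 + 1, h.2))) (θ : ℝ) :
    (¬ ∀ (ω : ΩG (dom (boxMinus m n S)) (Face.side (h.1 + 1, h.2) .W) (farW (h.1 + 1, h.2))) (hb : ω.IsB2a),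
        ω.2.firstSideG = .S → ω.WE (fun _ => θ) ≠ excursionWinding θ ω.2.firstSideG (ω.z1 hr hb) ω.1 →
          ¬ω.2.W2FreeOff (farW (h.1 + 1, h.2))) ∧
      (¬ ∀ (ω : ΩG (dom (boxMinus m n S)) (Face.side (h.1 + 1, h.2) .W) (farW (h.1 + 1, h.2))) (hb : ω.IsB2a),
        ω.2.firstSideG = .N → ω.WE (fun _ => θ) ≠ excursionWinding θ ω.2.firstSideG (ω.z1 hr hb) ω.1 →
          ¬ω.2.W1FreeOff (farW (h.1 + 1, h.2))) ∧
      (¬ ∀ (ω : ΩG (dom (boxMinus m n S)) (Face.side (h.1 + 1, h.2) .W) (farW (h.1 + 1, h.2))) (hb : ω.IsB2a),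
        ω.2.firstSideG = .S → ω.WE (fun _ => θ) ≠ excursionWinding θ ω.2.firstSideG (ω.z1 hr hb) ω.1 →
          ¬ω.2.W1FreeOff (farW (h.1 + 1, h.2))) ∧
      (¬ ∀ (ω : ΩG (dom (boxMinus m n S)) (Face.side (h.1 + 1, h.2) .W) (farW (h.1 + 1, h.2))) (hb : ω.IsB2a),
        ω.2.firstSideG = .N → ω.WE (fun _ => θ) ≠ excursionWinding θ ω.2.firstSideG (ω.z1 hr hb) ω.1 →
          ¬ω.2.W2FreeOff (farW (h.1 + 1, h.2))) := by
  obtain ⟨hWB, hEB⟩ := blocks_hroot_subset_boxMinus_of_far (m := m) (n := n) hW hE hS hN hSl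
  exact not_killed_of_blocks hWB hEB hr θ

/-- The rooted far cell of a box minus the hole and far cells — the hypothesis `hr`, discharged.
[cite: GlazmanManolescu2019, §2.1 (walks start on the boundary of the domain)] -/
theorem rootedFace_hroot_boxMinus_of_far (hW : 2 ≤ h.1) (hE : h.1 + 3 ≤ m) (hS : 2 ≤ h.2) (hN : h.2 + 3 ≤ n)
    (hh : h ∈ S) (hSl : ∀ s ∈ S, s = h ∨ FarFromHole h s) :
    RootedFace (dom (boxMinus m n S)) (Face.side (h.1 + 1, h.2) .W) (farW (h.1 + 1, h.2)) := by
  refine ⟨?_, fun hb => ?_⟩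
  · rw [mem_dom_boxMinus]
    simp only [farW]
    refine ⟨⟨by omega, by omega, by omega, by omega⟩, fun hs => ?_⟩
    rcases hSl _ hs with e | e
    · have e' := Prod.ext_iff.1 e; simp only at e'; omega
    · simp only [FarFromHole] at e; omega
  · rw [root_faces_W, holeFaceW_hroot] at hb
    exact not_mem_dom_boxMinus_of_mem hh hb.1

end Boxes

end Literature.Barriers.CriticalPhenomena.PlaquetteWalk
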